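import Summits.QuantumFields.YangMills.Theorems.FluctuationComparisonRegPrIntLLargeFieldGasBudget
import Literature.MathematicalPhysics.QuantumFieldTheory.BalabanImbrieJaffe1984to88.BIJ85BlockAveragesTorusK
import HarnessLib

/-!
# LFG^{can}∘ SOCKET LETTERS (G7): THE DEEP-LABEL LOCATOR AND THE PER-CUBE COUNT — `≤ 9·L^{3(i−J)}` labels of height `i` over one height-`J` cube — hence the
# budget row `hσ` of ✓`…LargeFieldGasKnitAE.canIntBody_of_factorised_histories` OUTRIGHT from ✓`…LargeFieldGasBudget.exists_deep_budget` (`c₀ := 9`)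

Cell `ym3-torus` (HUMAN RULING D-0037: rung R3 = continuum `SU(2)` Yang–Mills on `T³` — NOT `d = 4`, NOT infinite volume, NOT a mass gap, NOT the Clay problem); width seat
`ym3-torus-px10` (gen 17), FILE 8 of the px10 LFG lineage (FILE 7 = `…LargeFieldGasFootprint`); helper of the crux `stmt-QuantumFields-20520`
`UnitScaleTilt.FluctuationComparisonRegPrIntL` (`--supports … --as helper`, NOT a proof of it); the «per-block COUNT of deep labels (the geometric half of `hσ`)» that
✓`…LargeFieldGasBudget` left «with the hand» (its docstring) and `LOCATE-R1-DEPTH1-r3p1g0.md` §1 «LABELS ∕ CELLS» asks for.  THEOREMS ONLY: 0 `def`, 0 `instance`,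
0 `notation`, 0 `sorry`, default heartbeats.

THE LETTERS (all spelled inline, def-free).  Labels `Λ := LFLabel F K J = Σ j : Fin (K − J + 1), Plaq (F.P K) j` (✓`…HistoryPartitionDefs`); a label `⟨j, p⟩` has HEIGHT
`i = K − j` and is DEEP iff `j < K − J` (⇔ `i > J`).  LOCATOR (the height-`J` cube over the plaquette's base point, read on the height-`J` unit lattice `Site (F.P J) 0`):
`πsrc ⟨j, p⟩ := siteShift _ (blkIter (K − J − j) p.src)` — the `(K − J − j)`-fold block point of `p.src` (✓`BIJ85BlockAveragesTorusK.blkIter`, level `j ↦ K − J` of run `K`)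
carried to level `0` of run `J` by the tree's level identification ✓`T3LevelShift.siteShift` (moduli `2L^{m+J}` on both sides, ✓`T3Family.sitesPerDir_eq`) — the same
identification by which ✓`heightDensity` reads run `K` at height `J`; the bond locator of the socket is `π l := ⟨πsrc l, l.2.μ⟩`.  SMALL FACTORS: `sf ⟨j, p⟩ := smallFactor L γ b₀ p₀ a
(K − j)` on deep labels, `0` on the window-level labels `j = K − J` (they never enter an admissible sub-history: px10 g16's (W) ✓`…WindowCut`).
* §1 `card_plaq_filter_src_mem_le` — over a set `S` of sites there are `≤ d²·|S|` plaquettes (base point in `S`; `d² ≥ d(d−1)/2` orientations);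
  `card_plaq_filter_blkIter_le` — `≤ d²·L^{dℓ}` plaquettes of level `j` over one `ℓ`-fold block (✓`card_blockK`); `card_labels_at_level_le` — the located count per cube and level.
* §2 `sum_sf_fibre_le` — per cube `z`: `Σ_{l ∣ πsrc l = z} sf l ≤ Σ_{j < K − J} 9·L^{3(K−J−j)}·smallFactor (K − j)`; `sum_sf_located_le` — over a family `Fc` of cubes the located
  sum is `≤ |Fc| ·` that; `sum_deep_reindex` — the height reindexing `j ↦ i = K − j` onto `S := (range (K − J)).image (K − ·) ⊆ {i ∣ J < i}`.
* §3 ★★ `exists_located_budget` — for `1 < L`, `0 < γ ≤ 1`, `1 ≤ b₀`, `1 ≤ p₀`, `0 < a`: `∃ Ψ ≥ 0`, `J·Ψ J → 0`, `∀ J ≤ K, ∀ Fc, Σ_{l ∣ πsrc l ∈ Fc} sf l ≤ Ψ J·|Fc|` (families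
  `Fc` of FINE sites = unit cubes) for EVERY run `K`, by ✓`exists_deep_budget` with `c₀ := 9`.
* §4 ★★ `exists_located_budget_blocks` — the same per BIG BLOCK `B^μ(y)` (FILE 7's cells = Bałaban's `M`-cubes, `M = L^μ`): `Σ_{l ∣ B^μ(πsrc l) ∈ Fc} sf l ≤ Ψ J·|Fc|` with
  `Ψ := L^{3μ}·Ψ_{§3}` (`filter_blk_mem_eq`, `card_biUnion_iterBlock`); this is the socket's `hσ` with FILE 7's `size X = |blocks of X|`.

HONEST (CREDITS NOTHING): finite counting on the tree's block maps plus px10 g16's real-analysis budget; the engine rows of the socket (Bałaban's 𝐑-operation) are untouched;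
LFG^{can}∘ ∕ `stub_largeFieldFourPtIntCan` ∕ S2β ∕ the crux 20520 NOT proved; `YM3TorusSU2` NOT proved; the Yang–Mills mass gap (Clay) NOT proved; rung R3 = YM₃ on `T³` — NOT
`d = 4`, NOT infinite volume, NOT a mass gap.
References: [Balaban1985UV3] T. Bałaban, CMP 102 (1985): (7) p.257, (41) p.266, (67)–(71) pp.273–274 (one small factor per large plaquette, counted per big block);
[Balaban1989LargeFieldII] CMP 122 (1989): (1.100)–(1.101) p.390 (the pinned size of the large-field gas); [BalabanImbrieJaffe1985] CMP 97 (1985) (2.4), (5.1.2) (iterated blocks).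
-/

set_option autoImplicit false

noncomputable section

open Finset Filter Topology
open scoped BigOperators
open Literature.MathematicalPhysics.QuantumFieldTheory.Balaban1983to89
open Literature.MathematicalPhysics.QuantumFieldTheory.Balaban1983to89.T3ContinuumYM3Torus
open Literature.MathematicalPhysics.QuantumFieldTheory.Balaban1983to89.T3LevelShift (siteShift)
open Literature.MathematicalPhysics.QuantumFieldTheory.BalabanImbrieJaffe1984to88.BIJ85BlockAveragesTorusK (blkIter blockK mem_blockK card_blockK)
open Summit.QuantumFields.YangMills.Theorems.FluctuationComparisonRegPrIntLHistoryPartition (LFLabel smallFactor smallFactor_pos)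
open Summit.QuantumFields.YangMills.Theorems.FluctuationComparisonRegPrIntLLargeFieldGasBudget (exists_deep_budget)

namespace Summit.QuantumFields.YangMills.Theorems.FluctuationComparisonRegPrIntLLargeFieldGasLabelCount

/-! ## §1 Counting plaquettes over a set of base points and over one iterated block -/

section Count

variable {P : Params} {j : ℕ}

open Classical in
/-- **`≤ d²·|S|` PLAQUETTES HAVE THEIR BASE POINT IN `S`** (a plaquette is its base point and an ordered pair of directions). [cite: Balaban1985UV3, (7) p.257 (bookkeeping)] -/
theorem card_plaq_filter_src_mem_le (S : Finset (Site P j)) :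
    (Finset.univ.filter fun p : Plaq P j => p.src ∈ S).card ≤ P.d ^ 2 * S.card := by
  have hmap : ∀ p ∈ Finset.univ.filter (fun p : Plaq P j => p.src ∈ S),
      (fun p : Plaq P j => (p.src, p.μ, p.ν)) p ∈ S ×ˢ ((Finset.univ : Finset (Fin P.d)) ×ˢ (Finset.univ : Finset (Fin P.d))) := by
    intro p hp
    simp only [Finset.mem_filter, Finset.mem_univ, true_and] at hp
    simp [hp]
  have hinj : Set.InjOn (fun p : Plaq P j => (p.src, p.μ, p.ν)) ↑(Finset.univ.filter fun p : Plaq P j => p.src ∈ S) := by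
    intro p _ q _ h
    simp only [Prod.mk.injEq] at h
    obtain ⟨h1, h2, h3⟩ := h
    cases p; cases q
    simp only at h1 h2 h3
    subst h1; subst h2; subst h3
    rfl
  calc (Finset.univ.filter fun p : Plaq P j => p.src ∈ S).card
      ≤ (S ×ˢ ((Finset.univ : Finset (Fin P.d)) ×ˢ (Finset.univ : Finset (Fin P.d)))).card := Finset.card_le_card_of_injOn _ hmap hinj
    _ = P.d ^ 2 * S.card := by simp [Finset.card_product, sq, mul_comm]

open Classical in
/-- **`≤ d²·L^{dℓ}` PLAQUETTES OF LEVEL `j` OVER ONE `ℓ`-FOLD BLOCK** (`|B^ℓ(y)| = L^{ℓd}`, ✓`card_blockK`; standing range `j + ℓ ≤ m + K`). [cite: BalabanImbrieJaffe1985, (5.1.2) p.313 (bookkeeping)] -/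
theorem card_plaq_filter_blkIter_le {ℓ : ℕ} (hℓ : j + ℓ ≤ P.m + P.K) (y : Site P (j + ℓ)) :
    (Finset.univ.filter fun p : Plaq P j => blkIter ℓ p.src = y).card ≤ P.d ^ 2 * P.L ^ (ℓ * P.d) := by
  have heq : (Finset.univ.filter fun p : Plaq P j => blkIter ℓ p.src = y) = Finset.univ.filter fun p : Plaq P j => p.src ∈ blockK ℓ y := by
    ext p
    simp only [Finset.mem_filter, Finset.mem_univ, true_and, mem_blockK]
  rw [heq, ← card_blockK ℓ hℓ y]
  exact card_plaq_filter_src_mem_le _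

end Count

/-! ## §2 The located small-factor sums of the T³ tower -/

section Located

variable (F : T3Family) (γ b₀ p₀ a : ℝ) {J K : ℕ} (hJK : J ≤ K)

open Classical in
/-- **THE COUNT PER CUBE AND LEVEL**: over one height-`J` cube `z`, the labels of level `j ≤ K − J` located at `z` number `≤ 9·L^{3(K−J−j)}` (`d = 3`).
[cite: Balaban1985UV3, (41) p.266 (bookkeeping)] -/
theorem card_labels_at_level_le (j : Fin (K - J + 1)) (z : Site (F.P J) 0) :
    (Finset.univ.filter fun p : Plaq (F.P K) j.val =>
        siteShift (F.sitesPerDir_eq (m := F.m) (K := K) (j := j.val + (K - J - j.val)) (m' := F.m) (K' := J) (j' := 0)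
          (by have := j.isLt; omega)) (blkIter (K - J - j.val) p.src) = z).card ≤ 9 * F.L ^ (3 * (K - J - j.val)) := by
  have hj := j.isLt
  set h := F.sitesPerDir_eq (m := F.m) (K := K) (j := j.val + (K - J - j.val)) (m' := F.m) (K' := J) (j' := 0) (by omega) with hh
  have heq : (Finset.univ.filter fun p : Plaq (F.P K) j.val => siteShift h (blkIter (K - J - j.val) p.src) = z) =
      Finset.univ.filter fun p : Plaq (F.P K) j.val => blkIter (K - J - j.val) p.src = (siteShift h).symm z := by
    ext p
    simp only [Finset.mem_filter, Finset.mem_univ, true_and]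
    exact (Equiv.apply_eq_iff_eq_symm_apply (siteShift h))
  rw [heq]
  have hrange : j.val + (K - J - j.val) ≤ (F.P K).m + (F.P K).K := by
    show j.val + (K - J - j.val) ≤ F.m + K
    omega
  calc (Finset.univ.filter fun p : Plaq (F.P K) j.val => blkIter (K - J - j.val) p.src = (siteShift h).symm z).card
      ≤ (F.P K).d ^ 2 * (F.P K).L ^ ((K - J - j.val) * (F.P K).d) := card_plaq_filter_blkIter_le hrange _
    _ = 9 * F.L ^ (3 * (K - J - j.val)) := by
        rw [T3Family.P_d, show (F.P K).L = F.L from rfl]; ring_nf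

open Classical in
/-- **THE LOCATED SUM OVER ONE CUBE**: `Σ_{l ∣ πsrc l = z} sf l ≤ Σ_{j < K − J} 9·L^{3(K−J−j)}·smallFactor (K − j)` — split the labels by level (a `Σ`-type), the
window level contributes `0`, a deep level `j` contributes its count times `smallFactor (K − j)`. [cite: Balaban1985UV3, (41) p.266 and (67)-(71) pp.273-274 (bookkeeping)] -/
theorem sum_sf_fibre_le (z : Site (F.P J) 0) :
    ∑ l ∈ Finset.univ.filter (fun l : LFLabel F K J =>
        siteShift (F.sitesPerDir_eq (m := F.m) (K := K) (j := l.1.val + (K - J - l.1.val)) (m' := F.m) (K' := J) (j' := 0)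
          (by have := l.1.isLt; omega)) (blkIter (K - J - l.1.val) l.2.src) = z),
      (if l.1.val < K - J then smallFactor F.L γ b₀ p₀ a (K - l.1.val) else 0) ≤
      ∑ j ∈ Finset.range (K - J), 9 * (F.L : ℝ) ^ (3 * (K - J - j)) * smallFactor F.L γ b₀ p₀ a (K - j) := by
  rw [Finset.sum_filter]
  -- split the Σ-type sum by level
  have hsig : ∑ l : LFLabel F K J,
      (if siteShift (F.sitesPerDir_eq (m := F.m) (K := K) (j := l.1.val + (K - J - l.1.val)) (m' := F.m) (K' := J) (j' := 0)
          (by have := l.1.isLt; omega)) (blkIter (K - J - l.1.val) l.2.src) = z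
        then (if l.1.val < K - J then smallFactor F.L γ b₀ p₀ a (K - l.1.val) else 0) else 0) =
      ∑ j : Fin (K - J + 1), ∑ p : Plaq (F.P K) j.val,
        (if siteShift (F.sitesPerDir_eq (m := F.m) (K := K) (j := j.val + (K - J - j.val)) (m' := F.m) (K' := J) (j' := 0)
            (by have := j.isLt; omega)) (blkIter (K - J - j.val) p.src) = z
          then (if j.val < K - J then smallFactor F.L γ b₀ p₀ a (K - j.val) else 0) else 0) :=
    Fintype.sum_sigma _
  rw [hsig]
  -- per level: count × small factor (deep) or zero (window level)
  have hlev : ∀ j : Fin (K - J + 1), ∑ p : Plaq (F.P K) j.val,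
      (if siteShift (F.sitesPerDir_eq (m := F.m) (K := K) (j := j.val + (K - J - j.val)) (m' := F.m) (K' := J) (j' := 0)
          (by have := j.isLt; omega)) (blkIter (K - J - j.val) p.src) = z
        then (if j.val < K - J then smallFactor F.L γ b₀ p₀ a (K - j.val) else 0) else 0) ≤
      if j.val < K - J then 9 * (F.L : ℝ) ^ (3 * (K - J - j.val)) * smallFactor F.L γ b₀ p₀ a (K - j.val) else 0 := by
    intro j
    by_cases hdeep : j.val < K - J
    · simp only [hdeep, if_true]
      rw [← Finset.sum_filter, Finset.sum_const, nsmul_eq_mul]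
      have hc := card_labels_at_level_le F hJK j z
      have hsf : 0 ≤ smallFactor F.L γ b₀ p₀ a (K - j.val) := (smallFactor_pos _ _ _ _ _ _).le
      have hc' : ((Finset.univ.filter fun p : Plaq (F.P K) j.val =>
          siteShift (F.sitesPerDir_eq (m := F.m) (K := K) (j := j.val + (K - J - j.val)) (m' := F.m) (K' := J) (j' := 0)
            (by have := j.isLt; omega)) (blkIter (K - J - j.val) p.src) = z).card : ℝ) ≤ 9 * (F.L : ℝ) ^ (3 * (K - J - j.val)) := by
        exact_mod_cast hc
      exact mul_le_mul_of_nonneg_right hc' hsf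
    · simp only [hdeep, if_false]
      simp
  calc ∑ j : Fin (K - J + 1), ∑ p : Plaq (F.P K) j.val,
        (if siteShift (F.sitesPerDir_eq (m := F.m) (K := K) (j := j.val + (K - J - j.val)) (m' := F.m) (K' := J) (j' := 0)
            (by have := j.isLt; omega)) (blkIter (K - J - j.val) p.src) = z
          then (if j.val < K - J then smallFactor F.L γ b₀ p₀ a (K - j.val) else 0) else 0)
      ≤ ∑ j : Fin (K - J + 1), (if j.val < K - J then 9 * (F.L : ℝ) ^ (3 * (K - J - j.val)) * smallFactor F.L γ b₀ p₀ a (K - j.val) else 0) :=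
        Finset.sum_le_sum fun j _ => hlev j
    _ = ∑ j ∈ Finset.range (K - J), 9 * (F.L : ℝ) ^ (3 * (K - J - j)) * smallFactor F.L γ b₀ p₀ a (K - j) := by
        rw [Fin.sum_univ_eq_sum_range (fun j => if j < K - J then 9 * (F.L : ℝ) ^ (3 * (K - J - j)) * smallFactor F.L γ b₀ p₀ a (K - j) else 0) (K - J + 1),
          Finset.sum_range_succ, if_neg (lt_irrefl _), add_zero]
        exact Finset.sum_congr rfl fun j hj => if_pos (Finset.mem_range.mp hj)

open Classical in
/-- **THE LOCATED SUM OVER A FAMILY OF CUBES** is at most `|Fc|` times the per-cube bound (fibrewise over the locator). [cite: Balaban1985UV3, (41) p.266 (bookkeeping)] -/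
theorem sum_sf_located_le (Fc : Finset (Site (F.P J) 0)) :
    ∑ l ∈ Finset.univ.filter (fun l : LFLabel F K J =>
        siteShift (F.sitesPerDir_eq (m := F.m) (K := K) (j := l.1.val + (K - J - l.1.val)) (m' := F.m) (K' := J) (j' := 0)
          (by have := l.1.isLt; omega)) (blkIter (K - J - l.1.val) l.2.src) ∈ Fc),
      (if l.1.val < K - J then smallFactor F.L γ b₀ p₀ a (K - l.1.val) else 0) ≤
      (Fc.card : ℝ) * ∑ j ∈ Finset.range (K - J), 9 * (F.L : ℝ) ^ (3 * (K - J - j)) * smallFactor F.L γ b₀ p₀ a (K - j) := by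
  rw [← Finset.sum_fiberwise_of_maps_to (s := Finset.univ.filter (fun l : LFLabel F K J =>
        siteShift (F.sitesPerDir_eq (m := F.m) (K := K) (j := l.1.val + (K - J - l.1.val)) (m' := F.m) (K' := J) (j' := 0)
          (by have := l.1.isLt; omega)) (blkIter (K - J - l.1.val) l.2.src) ∈ Fc)) (t := Fc)
      (g := fun l : LFLabel F K J =>
        siteShift (F.sitesPerDir_eq (m := F.m) (K := K) (j := l.1.val + (K - J - l.1.val)) (m' := F.m) (K' := J) (j' := 0)
          (by have := l.1.isLt; omega)) (blkIter (K - J - l.1.val) l.2.src))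
      (fun l hl => (Finset.mem_filter.mp hl).2)]
  have hfib : ∀ z ∈ Fc, ∑ l ∈ (Finset.univ.filter (fun l : LFLabel F K J =>
        siteShift (F.sitesPerDir_eq (m := F.m) (K := K) (j := l.1.val + (K - J - l.1.val)) (m' := F.m) (K' := J) (j' := 0)
          (by have := l.1.isLt; omega)) (blkIter (K - J - l.1.val) l.2.src) ∈ Fc)).filter (fun l =>
        siteShift (F.sitesPerDir_eq (m := F.m) (K := K) (j := l.1.val + (K - J - l.1.val)) (m' := F.m) (K' := J) (j' := 0)
          (by have := l.1.isLt; omega)) (blkIter (K - J - l.1.val) l.2.src) = z),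
      (if l.1.val < K - J then smallFactor F.L γ b₀ p₀ a (K - l.1.val) else 0) ≤
      ∑ j ∈ Finset.range (K - J), 9 * (F.L : ℝ) ^ (3 * (K - J - j)) * smallFactor F.L γ b₀ p₀ a (K - j) := by
    intro z hz
    rw [Finset.filter_filter]
    refine le_trans (Finset.sum_le_sum_of_subset_of_nonneg (fun l hl => ?_) (fun l _ _ => ?_)) (sum_sf_fibre_le F γ b₀ p₀ a hJK z)
    · simp only [Finset.mem_filter, Finset.mem_univ, true_and] at hl ⊢
      exact hl.2
    · split_ifs
      · exact (smallFactor_pos _ _ _ _ _ _).le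
      · exact le_rfl
  calc _ ≤ ∑ _z ∈ Fc, ∑ j ∈ Finset.range (K - J), 9 * (F.L : ℝ) ^ (3 * (K - J - j)) * smallFactor F.L γ b₀ p₀ a (K - j) :=
        Finset.sum_le_sum hfib
    _ = (Fc.card : ℝ) * ∑ j ∈ Finset.range (K - J), 9 * (F.L : ℝ) ^ (3 * (K - J - j)) * smallFactor F.L γ b₀ p₀ a (K - j) := by
        rw [Finset.sum_const, nsmul_eq_mul]

/-- **HEIGHT REINDEXING** `j ↦ i = K − j`: the per-cube bound is the sum `Σ_{i ∈ S} 9·L^{3(i−J)}·smallFactor i` over the deep heights `S := (range (K − J)).image (K − ·)`, all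
strictly above `J`. [cite: Balaban1985UV3, (41) p.266 (bookkeeping)] -/
theorem sum_deep_reindex :
    ∑ j ∈ Finset.range (K - J), 9 * (F.L : ℝ) ^ (3 * (K - J - j)) * smallFactor F.L γ b₀ p₀ a (K - j) =
      ∑ i ∈ (Finset.range (K - J)).image (fun j => K - j), 9 * (F.L : ℝ) ^ (3 * (i - J)) * smallFactor F.L γ b₀ p₀ a i := by
  have hinj : Set.InjOn (fun j => K - j) ↑(Finset.range (K - J)) := by
    intro x hx y hy hxy
    have hx' := Finset.mem_range.mp hx; have hy' := Finset.mem_range.mp hy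
    simp only at hxy
    omega
  rw [Finset.sum_image hinj]
  refine Finset.sum_congr rfl fun j hj => ?_
  have hj' := Finset.mem_range.mp hj
  have h3 : 3 * (K - J - j) = 3 * (K - j - J) := by omega
  rw [h3]

/-- The deep heights of a run lie strictly above the comparison height. [cite: Balaban1985UV3, (41) p.266 (bookkeeping)] -/
theorem deep_heights_gt : ∀ i ∈ (Finset.range (K - J)).image (fun j => K - j), J < i := by
  intro i hi
  obtain ⟨j, hj, rfl⟩ := Finset.mem_image.mp hi
  have := Finset.mem_range.mp hj
  omega

end Located

/-! ## §3 The budget row `hσ` of the socket, for every run -/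

section Budget

variable (F : T3Family) {γ b₀ p₀ a : ℝ}

open Classical in
/-- ★★ **THE LOCATED BUDGET, UNIFORM IN THE RUN**: for `1 < L`, `0 < γ ≤ 1`, `1 ≤ b₀`, `1 ≤ p₀`, `0 < a` there is `Ψ ≥ 0` with `J·Ψ J → 0` such that for EVERY `J ≤ K` and every
family `Fc` of height-`J` cubes the small factors of the labels located over `Fc` sum to `≤ Ψ J·|Fc|` — the socket's `hσ` with FILE 7's `size (Fc.biUnion cell) = |Fc|`
(✓`exists_deep_budget`, `c₀ := 9`, over the deep heights of the run). [cite: Balaban1985UV3, (41) p.266 and (67)-(71) pp.273-274; Balaban1989LargeFieldII, (1.100)-(1.101) p.390] -/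
theorem exists_located_budget (hγ : 0 < γ) (hγ1 : γ ≤ 1) (hb : 1 ≤ b₀) (hp : 1 ≤ p₀) (ha : 0 < a) :
    ∃ Ψ : ℕ → ℝ, (∀ J, 0 ≤ Ψ J) ∧ Tendsto (fun J : ℕ => (J : ℝ) * Ψ J) atTop (𝓝 0) ∧
      ∀ (J K : ℕ) (hJK : J ≤ K) (Fc : Finset (Site (F.P J) 0)),
        ∑ l ∈ Finset.univ.filter (fun l : LFLabel F K J =>
            siteShift (F.sitesPerDir_eq (m := F.m) (K := K) (j := l.1.val + (K - J - l.1.val)) (m' := F.m) (K' := J) (j' := 0)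
              (by have := l.1.isLt; omega)) (blkIter (K - J - l.1.val) l.2.src) ∈ Fc),
          (if l.1.val < K - J then smallFactor F.L γ b₀ p₀ a (K - l.1.val) else 0) ≤ Ψ J * (Fc.card : ℝ) := by
  obtain ⟨Ψ, hΨ0, hΨt, hΨ⟩ := exists_deep_budget F.hL.2 hγ hγ1 hb hp ha (c₀ := 9) (by norm_num)
  refine ⟨Ψ, hΨ0, hΨt, fun J K hJK Fc => ?_⟩
  have h1 := sum_sf_located_le F γ b₀ p₀ a hJK Fc
  have h2 : ∑ j ∈ Finset.range (K - J), 9 * (F.L : ℝ) ^ (3 * (K - J - j)) * smallFactor F.L γ b₀ p₀ a (K - j) ≤ Ψ J := by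
    rw [sum_deep_reindex F γ b₀ p₀ a]
    exact hΨ J _ (deep_heights_gt (J := J) (K := K))
  calc _ ≤ (Fc.card : ℝ) * ∑ j ∈ Finset.range (K - J), 9 * (F.L : ℝ) ^ (3 * (K - J - j)) * smallFactor F.L γ b₀ p₀ a (K - j) := h1
    _ ≤ (Fc.card : ℝ) * Ψ J := mul_le_mul_of_nonneg_left h2 (Nat.cast_nonneg _)
    _ = Ψ J * (Fc.card : ℝ) := mul_comm _ _

end Budget

/-! ## §4 The budget row per BIG BLOCK (Bałaban's `M`-cubes, `M = L^μ`; FILE 7's cells) -/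

section Blocks

variable (F : T3Family) {γ b₀ p₀ a : ℝ}

open Classical in
/-- **LOCATED OVER A FAMILY OF BLOCKS = LOCATED OVER THE FINE SITES UNDER IT**: `{l ∣ B^μ(πsrc l) ∈ Fc} = {l ∣ πsrc l ∈ ⋃_{y ∈ Fc} B^μ(y)}`. [cite: Balaban1987RG1, (0.1) p.251 (bookkeeping)] -/
theorem filter_blk_mem_eq {J K : ℕ} (hJK : J ≤ K) (μ : ℕ) (Fc : Finset (Site (F.P J) μ)) :
    (Finset.univ.filter (fun l : LFLabel F K J =>
        B5Eq118OneStroke.iterBlockOf μ (siteShift (F.sitesPerDir_eq (m := F.m) (K := K) (j := l.1.val + (K - J - l.1.val)) (m' := F.m) (K' := J) (j' := 0)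
          (by have := l.1.isLt; omega)) (blkIter (K - J - l.1.val) l.2.src)) ∈ Fc)) =
      Finset.univ.filter (fun l : LFLabel F K J =>
        siteShift (F.sitesPerDir_eq (m := F.m) (K := K) (j := l.1.val + (K - J - l.1.val)) (m' := F.m) (K' := J) (j' := 0)
          (by have := l.1.isLt; omega)) (blkIter (K - J - l.1.val) l.2.src) ∈ Fc.biUnion (B5Eq118OneStroke.iterBlock μ)) := by
  refine Finset.filter_congr fun l _ => ⟨fun h => Finset.mem_biUnion.mpr ⟨_, h, (B5Eq118OneStroke.mem_iterBlock _ _ _).mpr rfl⟩, fun h => ?_⟩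
  obtain ⟨y, hy, hyl⟩ := Finset.mem_biUnion.mp h
  have hyl' := (B5Eq118OneStroke.mem_iterBlock _ _ _).mp hyl
  exact hyl' ▸ hy

/-- **THE FINE SITES UNDER `n` BLOCKS NUMBER `n·L^{3μ}`** (disjoint blocks of `L^{3μ}` sites each, ✓`card_iterBlock`; standing range `μ ≤ m + J`). [cite: Balaban1984PropagatorsI, (1.18) p.20 (bookkeeping)] -/
theorem card_biUnion_iterBlock {J : ℕ} {μ : ℕ} (hμ : μ ≤ F.m + J) (Fc : Finset (Site (F.P J) μ)) :
    (Fc.biUnion (B5Eq118OneStroke.iterBlock μ)).card = Fc.card * (F.L ^ 3) ^ μ := by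
  rw [Finset.card_biUnion (B5Eq118OneStroke.pairwiseDisjoint_iterBlock μ _)]
  have h : ∀ y ∈ Fc, (B5Eq118OneStroke.iterBlock μ y).card = (F.L ^ 3) ^ μ := fun y _ =>
    B5Eq118OneStroke.card_iterBlock μ (show μ ≤ (F.P J).m + (F.P J).K from hμ) y
  rw [Finset.sum_congr rfl h, Finset.sum_const, smul_eq_mul]

open Classical in
/-- ★★ **THE LOCATED BUDGET PER BIG BLOCK, UNIFORM IN THE RUN**: for `1 < L`, `0 < γ ≤ 1`, `1 ≤ b₀`, `1 ≤ p₀`, `0 < a` and a grain `μ` there is `Ψ ≥ 0` with `J·Ψ J → 0`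
(`Ψ = L^{3μ}·Ψ_{§3}`) such that for EVERY `J ≤ K` with `μ ≤ m + J` and every family `Fc` of `μ`-blocks of the height-`J` lattice, the small factors of the labels located under `Fc`
sum to `≤ Ψ J·|Fc|` — the socket's `hσ` in FILE 7's big-block geometry (`size X = |blocks|`). [cite: Balaban1985UV3, (41) p.266 and (67)-(71) pp.273-274; Balaban1989LargeFieldII, (1.100)-(1.101) p.390] -/
theorem exists_located_budget_blocks (hγ : 0 < γ) (hγ1 : γ ≤ 1) (hb : 1 ≤ b₀) (hp : 1 ≤ p₀) (ha : 0 < a) (μ : ℕ) :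
    ∃ Ψ : ℕ → ℝ, (∀ J, 0 ≤ Ψ J) ∧ Tendsto (fun J : ℕ => (J : ℝ) * Ψ J) atTop (𝓝 0) ∧
      ∀ (J K : ℕ) (hJK : J ≤ K), μ ≤ F.m + J → ∀ Fc : Finset (Site (F.P J) μ),
        ∑ l ∈ Finset.univ.filter (fun l : LFLabel F K J =>
            B5Eq118OneStroke.iterBlockOf μ (siteShift (F.sitesPerDir_eq (m := F.m) (K := K) (j := l.1.val + (K - J - l.1.val)) (m' := F.m) (K' := J) (j' := 0)
              (by have := l.1.isLt; omega)) (blkIter (K - J - l.1.val) l.2.src)) ∈ Fc),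
          (if l.1.val < K - J then smallFactor F.L γ b₀ p₀ a (K - l.1.val) else 0) ≤ Ψ J * (Fc.card : ℝ) := by
  obtain ⟨Ψ, hΨ0, hΨt, hΨ⟩ := exists_located_budget F hγ hγ1 hb hp ha
  refine ⟨fun J => ((F.L : ℝ) ^ 3) ^ μ * Ψ J, fun J => mul_nonneg (by positivity) (hΨ0 J), ?_, fun J K hJK hμ Fc => ?_⟩
  · have h := hΨt.const_mul (((F.L : ℝ) ^ 3) ^ μ)
    rw [mul_zero] at h
    refine h.congr fun J => ?_
    ring
  · rw [filter_blk_mem_eq F hJK μ Fc]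
    have h1 := hΨ J K hJK (Fc.biUnion (B5Eq118OneStroke.iterBlock μ))
    rw [card_biUnion_iterBlock F hμ Fc] at h1
    calc _ ≤ Ψ J * ((Fc.card * (F.L ^ 3) ^ μ : ℕ) : ℝ) := h1
      _ = ((F.L : ℝ) ^ 3) ^ μ * Ψ J * (Fc.card : ℝ) := by push_cast; ring

end Blocks

end Summit.QuantumFields.YangMills.Theorems.FluctuationComparisonRegPrIntLLargeFieldGasLabelCount

end
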